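import Literature.NumberTheory.EllipticCurves.AbelianVarietyBridgeFull
import Literature.NumberTheory.EllipticCurves.WeierstrassAddLawCharts
import Literature.NumberTheory.EllipticCurves.WeierstrassSchemeNeg
import HarnessLib

/-!
# Proof of `WeierstrassCurve.nonempty_abelianVarietyBridgeFull`

The named fact `WeierstrassCurve.nonempty_abelianVarietyBridgeFull W W'`
(`EllipticCurves/AbelianVarietyBridgeFull`): for elliptic curves `W, W'` over a perfect field `K`
there are bridge data — abelian varieties `A, A'` over `K` with `Γ_K`-equivariant additive
isomorphisms `A(K̄) ≅ E(K̄)`, `A'(K̄) ≅ E'(K̄)` under which all non-zero `K`-homomorphisms between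
`A, A'` are isogenies on points (Silverman, *AEC*, III.3.1(c), III.3.6, III.4.8, III.4.9). This file
discharges it (`nonempty_abelianVarietyBridgeFull_holds`) by assembling the tree's pieces:

* the addition morphism `W.addHom : E_W ⊗ E_W ⟶ E_W` with `⟨[P], [Q]⟩ ≫ addHom = [P + Q]` on
  `K̄`-points (`WeierstrassAddLawCharts.lift_pointEquiv_comp_addHom`: the two complete addition laws
  `addXYZ`, `add₂XYZ` of Bosma–Lenstra (`WeierstrassAddLawTwo`, `WeierstrassAddLawsComplete`) as law
  charts, glued by `WeierstrassAddAtlas`; AEC III.3.6);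
* the negation morphism `W.negHom : E_W ⟶ E_W` with `[P] ≫ negHom = [−P]`
  (`WeierstrassSchemeNeg.pointEquiv_comp_negHom_geom`; AEC III.2.3);
* `nonempty_abelianVarietyBridgeFull_of_addHom` (`AbelianVarietyModelOfAddHom`): from such `add`,
  `neg` for `W` and `W'`, the smooth plane cubics are abelian-variety models of the curves
  (group-scheme axioms checked on `K̄`-points, AEC III.3.6; affine chart `Spec K[W] ↪ E_W`,
  AEC III.1) and homomorphisms of models are isogenies on points (`AbelianVarietyModelIsogeny`,
  AEC III.4.8–III.4.9).

## References

* [SilvermanAEC2009] J. H. Silverman, *The Arithmetic of Elliptic Curves*, 2nd ed., GTM 106,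
  Springer 2009: I.2, III.1, III.2, III.2.3, III.3.1(c), III.3.6, III.4.8, III.4.9.
* [BosmaLenstra1995] W. Bosma, H. W. Lenstra, J. Number Theory 53 (1995), Theorem 2.

## Design

A pure proof file: `namespace WeierstrassCurve`, universe `u`, as the fact's file; the statement of the
fact is unchanged and no new named fact is introduced.
-/

noncomputable section

open CategoryTheory

universe u

namespace WeierstrassCurve

variable {K : Type u} [Field K] (W W' : WeierstrassCurve K)

/-- **Elliptic curves are abelian varieties of dimension one — bridge data for all four `Hom`-groups
of the pair** (discharge of the named fact `nonempty_abelianVarietyBridgeFull`): for `K` perfect and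
`W, W'` elliptic, the smooth plane cubics `E_W, E_{W'}` with base point `O = [0, 1, 0]`, the
chord–tangent addition morphism and the negation morphism are abelian varieties over `K`
(Silverman, *AEC*, III.3.1(c), III.3.6) whose `K̄`-points are `W(K̄), W'(K̄)` `Γ_K`-equivariantly
(III.1–III.2, I.2), and every non-zero `K`-homomorphism between them is on points an isogeny defined
over `K` (III.4.8, III.4.9). [cite: SilvermanAEC2009, III.3.1(c), III.3.6, III.4.8, III.4.9] -/
theorem nonempty_abelianVarietyBridgeFull_holds : nonempty_abelianVarietyBridgeFull W W' :=
  nonempty_abelianVarietyBridgeFull_of_addHom W W'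
    (fun {_} => ⟨W.addHom, W.negHom, W.lift_pointEquiv_comp_addHom, W.pointEquiv_comp_negHom_geom⟩)
    (fun {_} => ⟨W'.addHom, W'.negHom, W'.lift_pointEquiv_comp_addHom, W'.pointEquiv_comp_negHom_geom⟩)

end WeierstrassCurve
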